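import Summits.CriticalPhenomena.PercolationContinuityZ3.Theorems.PercNearOneGluingNoHeavyLowerTailSahiCombTriWAntiNested
import Summits.CriticalPhenomena.PercolationContinuityZ3.Theorems.PercNearOneGluingNoHeavyLowerTailSahiCombFourChainIneq

/-!
# `TRI_W(2) ≥ 0` on the TOP-COLLAPSED ANTI-NESTED stratum (`F{b} ⊆ F{a} = F univ`, `G{a} ⊆ G{b} = G univ`) — unconditional, via AN♯1

Support file of the one-cut programme (crux `NoHeavyLowerTail`, stmt-CriticalPhenomena-4575; TRI lane of cell `prim-masterthm`; seat prim-lf-1 gen 37,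
memo `FROM-prim-lf-1-gen37-ANTINESTED-AND-LOCALITY.md` §2).  Target `FiveUpSet.TriWIneq` (OPEN for `a ≥ 2`).

The anti-nested stratum of `TRI_W(2)` (`F{b} ⊆ F{a}`, `G{a} ⊆ G{b}`; both families 4-chains along opposite linear extensions of the index square) is reduced in
`…SahiCombTriWAntiNested` / `…SahiCombTriWAntiNestedKernel` to the (unproved) rank lemma AN♯3.  This file settles UNCONDITIONALLY its sub-stratum in which the two
LARGER middle sets equal the tops (`F{a} = F univ`, `G{b} = G univ`): there the four-chain inequality AN♯1 that IS in the tree (`FiveUpSet.fourChainIneq_holds`,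
cell P5 gen 16), applied to the chains `(F ∅, F{b}, F univ, F univ)` and `(G ∅, G{a}, G univ, G univ)`, is exactly the missing piece:

* **`FiveUpSet.pair_nonneg_of_antiNested_topEq`** — for up-sets `P`, `F₀ ⊆ F₁ ⊆ F₂`, `G₀ ⊆ G₁ ⊆ G₂` of a finite cube:
  `0 ≤ triWOne(P;F₀,F₂;G₀,G₂) + triWOne(P;F₂,F₁;G₁,G₂)`.  PROOF (certificate found by the type-level LP of this seat, kit j160093, then checked as a formal
  identity in the twenty atoms): the pair sum EQUALS `[AN♯1 slack for (F₀,F₁,F₂,F₂;G₀,G₁,G₂,G₂)] + Kl_{P∩G₀}(F₂) + Kl_{P∩F₀}(G₂) + Kl_{P∩G₁}(F₁) + Kl_{P∩F₁}(G₁)`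
  `+ [#(P ∩ (F₂\F₀) ∩ (G₂\G₀)) − #(P ∩ (F₂\F₁) ∩ (G₂\G₁))]`, every bracket non-negative (AN♯1, Kleitman ×4, a sub-box);
* **`FiveUpSet.triW_nonneg_of_antiNested_topEq`** — index cube with two atoms `a ≠ b`, up-set `P`, monotone families of up-sets `F, G` with
  `F {b} ⊆ F {a} = F univ` and `G {a} ⊆ G {b} = G univ`: `0 ≤ triW P F G`.
Not contained in the tree's strata (`pairwise_nested[_or_const]`, untilted, bot-empty, `left_bot_right_top`, `*_of_bot_eq`, `*_of_top_eq` (those need `G univ = ⊤`),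
self-dual/principal `P`): here the inner pair is crossed in opposite directions with `F ∅, G ∅ ≠ ∅` and `G univ ≠ ⊤` allowed.  By the type-level LPs of the memo
(kit j160084–j160092) the other one- and two-equality degenerations of the anti-nested stratum (`F ∅ = F{b}`, `G ∅ = G{a}`, one top equality alone, …) are NOT
reachable this way — they need AN♯3.
HONEST LABEL: one new unconditional (small) stratum of `TriWIneq` at `a = 2`; the anti-nested stratum itself and `TriWIneq` remain OPEN. [this work]
-/

namespace Summit.CriticalPhenomena.PercolationContinuityZ3.Theorems

namespace FiveUpSet

open Finset LatticeFiveUpSet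

variable {γ : Type} [DecidableEq γ] [Fintype γ]

/-- **Top-collapsed anti-nested pair sum is non-negative** (unconditional): for up-sets `P`, `F₀ ⊆ F₁ ⊆ F₂`, `G₀ ⊆ G₁ ⊆ G₂` of a finite cube,
`0 ≤ triWOne(P;F₀,F₂;G₀,G₂) + triWOne(P;F₂,F₁;G₁,G₂)` — AN♯1 for `(F₀,F₁,F₂,F₂;G₀,G₁,G₂,G₂)` + four Kleitman gaps + a sub-box, by an exact identity. [this work] -/
theorem pair_nonneg_of_antiNested_topEq (P F₀ F₁ F₂ G₀ G₁ G₂ : Finset (Finset γ)) (hP : IsUpperSet (P : Set (Finset γ)))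
    (hF₀ : IsUpperSet (F₀ : Set (Finset γ))) (hF₁ : IsUpperSet (F₁ : Set (Finset γ))) (hF₂ : IsUpperSet (F₂ : Set (Finset γ)))
    (hG₀ : IsUpperSet (G₀ : Set (Finset γ))) (hG₁ : IsUpperSet (G₁ : Set (Finset γ))) (hG₂ : IsUpperSet (G₂ : Set (Finset γ)))
    (hF₀₁ : F₀ ⊆ F₁) (hF₁₂ : F₁ ⊆ F₂) (hG₀₁ : G₀ ⊆ G₁) (hG₁₂ : G₁ ⊆ G₂) :
    0 ≤ triWOne (complEquiv γ) P F₀ F₂ G₀ G₂ + triWOne (complEquiv γ) P F₂ F₁ G₁ G₂ := by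
  -- AN♯1 for the 4-chains (F₀,F₁,F₂,F₂), (G₀,G₁,G₂,G₂), massaged into canonical atoms
  have h4 := fourChainIneq_holds P F₀ F₁ F₂ F₂ G₀ G₁ G₂ G₂ hP hF₀ hF₁ hF₂ hF₂ hG₀ hG₁ hG₂ hG₂ hF₀₁ hF₁₂ subset_rfl hG₀₁ hG₁₂ subset_rfl
  have u1 : F₂ ∩ G₂ ∪ F₂ ∩ G₂ = F₂ ∩ G₂ := Finset.union_idempotent _
  have u2 : P ∩ (F₂ ∩ G₂) = P ∩ F₂ ∩ G₂ := (inter_assoc _ _ _).symm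
  have u3 : P ∩ (F₀ ∩ G₀) = P ∩ F₀ ∩ G₀ := (inter_assoc _ _ _).symm
  have u4 : P ∩ G₂ ∩ refl F₀ = P ∩ refl F₀ ∩ G₂ := inter_right_comm _ _ _
  have u5 : P ∩ G₂ ∩ refl F₂ = P ∩ refl F₂ ∩ G₂ := inter_right_comm _ _ _
  rw [u1, u2, u3, u4, u5] at h4
  -- bookkeeping identities
  have hsig := card_inter_refl_sigma P F₀ F₁ F₂ F₂ G₀ G₁ G₂ G₂ hF₀₁ hF₁₂ subset_rfl hG₀₁ hG₁₂ subset_rfl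
  have hun := card_inter_union_chain P F₁ F₂ G₁ G₂ hF₁₂ hG₁₂
  -- four Kleitman inequalities
  have hPG₀ : IsUpperSet ((P ∩ G₀ : Finset (Finset γ)) : Set (Finset γ)) := by rw [coe_inter]; exact hP.inter hG₀
  have hPF₀ : IsUpperSet ((P ∩ F₀ : Finset (Finset γ)) : Set (Finset γ)) := by rw [coe_inter]; exact hP.inter hF₀
  have hPG₁ : IsUpperSet ((P ∩ G₁ : Finset (Finset γ)) : Set (Finset γ)) := by rw [coe_inter]; exact hP.inter hG₁
  have hPF₁ : IsUpperSet ((P ∩ F₁ : Finset (Finset γ)) : Set (Finset γ)) := by rw [coe_inter]; exact hP.inter hF₁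
  have k1 := card_inter_refl_le hPG₀ hF₂
  have k2 := card_inter_refl_le hPF₀ hG₂
  have k3 := card_inter_refl_le hPG₁ hF₁
  have k4 := card_inter_refl_le hPF₁ hG₁
  have e1 : P ∩ G₀ ∩ refl F₂ = P ∩ refl F₂ ∩ G₀ := inter_right_comm _ _ _
  have e1' : P ∩ G₀ ∩ F₂ = P ∩ F₂ ∩ G₀ := inter_right_comm _ _ _
  have e3 : P ∩ G₁ ∩ refl F₁ = P ∩ refl F₁ ∩ G₁ := inter_right_comm _ _ _
  have e3' : P ∩ G₁ ∩ F₁ = P ∩ F₁ ∩ G₁ := inter_right_comm _ _ _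
  rw [e1, e1'] at k1
  rw [e3, e3'] at k3
  -- the inner box sits inside the outer box
  have hbox : (P ∩ (F₂ \ F₁) ∩ (G₂ \ G₁)).card ≤ (P ∩ (F₂ \ F₀) ∩ (G₂ \ G₀)).card := by
    refine card_le_card ?_
    intro s hs
    simp only [mem_inter, mem_sdiff] at hs ⊢
    exact ⟨⟨hs.1.1, hs.1.2.1, fun h0 => hs.1.2.2 (hF₀₁ h0)⟩, hs.2.1, fun h0 => hs.2.2 (hG₀₁ h0)⟩
  have sbig := card_shell_inter_add P F₀ F₂ G₀ G₂ (hF₀₁.trans hF₁₂) (hG₀₁.trans hG₁₂)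
  have ssmall := card_shell_inter_add P F₁ F₂ G₁ G₂ hF₁₂ hG₁₂
  unfold triWOne
  simp only [image_complEquiv]
  omega

/-- **STRATUM `F{b} ⊆ F{a} = F univ`, `G{a} ⊆ G{b} = G univ` of `TRI_W(2) ≥ 0` (unconditional):** index cube with two atoms `a ≠ b`, up-set `P`, monotone
families of up-sets `F, G` whose inner pair is crossed in OPPOSITE directions with both larger middle sets equal to the top: `0 ≤ triW P F G`.
(Pair reduction `LatticeFiveUpSet.triW_nonneg_of_pair_nonneg` + `pair_nonneg_of_antiNested_topEq`; the mirror stratum is the same statement with `a, b`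
exchanged.) [this work] -/
theorem triW_nonneg_of_antiNested_topEq {β : Type} [DecidableEq β] [Fintype β] {a b : β} (hab : a ≠ b) (hu : (univ : Finset β) = {a, b})
    (P : Finset (Finset γ)) (F G : Finset β → Finset (Finset γ))
    (hP : IsUpperSet (P : Set (Finset γ))) (hF : ∀ x, IsUpperSet (F x : Set (Finset γ))) (hG : ∀ x, IsUpperSet (G x : Set (Finset γ)))
    (hFm : Monotone F) (hGm : Monotone G) (hFba : F {b} ⊆ F {a}) (hGab : G {a} ⊆ G {b}) (hFa : F {a} = F univ) (hGb : G {b} = G univ) :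
    0 ≤ triW P F G := by
  refine triW_nonneg_of_pair_nonneg hab hu P F G ?_
  rw [← hFa, ← hGb]
  exact pair_nonneg_of_antiNested_topEq P (F ∅) (F {b}) (F {a}) (G ∅) (G {a}) (G {b}) hP (hF ∅) (hF {b}) (hF {a}) (hG ∅) (hG {a}) (hG {b})
    (hFm (empty_subset _)) hFba (hGm (empty_subset _)) hGab

/-- **STRATUM `F{a} = F univ ∧ G{b} = G univ` of `TRI_W(2) ≥ 0` (unconditional; the two families are TOP-EQUAL at OPPOSITE middle indices).**  The
containments `F{b} ⊆ F{a}` and `G{a} ⊆ G{b}` of `triW_nonneg_of_antiNested_topEq` are automatic here (`F{b} ⊆ F univ = F{a}`), so this is a clean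
two-condition stratum in the sense of the stratum map of report `P5-LORENTZIAN-TEST.md` §19.6 — complementary to `triW_nonneg_of_top_univ_of_top_eq`
(`G univ = ⊤ ∧ F{a} = F univ`): no `⊤` is required, the price is the second top-equality at the opposite index. [this work] -/
theorem triW_nonneg_of_crossed_topEq {β : Type} [DecidableEq β] [Fintype β] {a b : β} (hab : a ≠ b) (hu : (univ : Finset β) = {a, b})
    (P : Finset (Finset γ)) (F G : Finset β → Finset (Finset γ))
    (hP : IsUpperSet (P : Set (Finset γ))) (hF : ∀ x, IsUpperSet (F x : Set (Finset γ))) (hG : ∀ x, IsUpperSet (G x : Set (Finset γ)))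
    (hFm : Monotone F) (hGm : Monotone G) (hFa : F {a} = F univ) (hGb : G {b} = G univ) :
    0 ≤ triW P F G :=
  triW_nonneg_of_antiNested_topEq hab hu P F G hP hF hG hFm hGm (hFa ▸ hFm (subset_univ _)) (hGb ▸ hGm (subset_univ _)) hFa hGb

end FiveUpSet

end Summit.CriticalPhenomena.PercolationContinuityZ3.Theorems
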